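import Mathlib

/-!
# PairingTransfer — the dual step of the Albanese transfer (Tier 4, T4-A), kernel-checked

Seat p3 of the blind cell `pub-hodge-repro2` (Tier 4, README §6).  Nothing here depends on any
other file of the cell; the geometry enters only through named hypotheses.

## What is formalised

The closer shape of the brief produces an ALGEBRAIC CLASS OF COMPLEMENTARY DEGREE: for the
correspondence `f = (f₁,…,f₄) : S → B = ∏ A_{T_i}` from the compact Picard modular surface to the
corner product, the class `f_*[S]` lives in `H^{2g-4}(B,ℚ)` (`g = dim B = 12`), while the split
Weil line `W = W_𝐅(B) = ⋀⁴_𝐅 H¹(B,ℚ)` lives in `H⁴(B,ℚ)`.  The period input of the transfer is the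
Poincaré pairing `⟨f_*[S], w⟩ = ∫_S f^*w` for `w ∈ W`.  This file proves, with every geometric
input an explicit hypothesis, that

  ⟨c, w⟩ ≠ 0 for one algebraic `c` of complementary degree and one `w ∈ W`  ⟹  `W` is algebraic,

and (with the symmetric hypothesis) the converse, so that the non-vanishing of the period is
EXACTLY where the transfer closes or fails.  The inputs are:

* `pair` — the Poincaré pairing `H^{2g-4}(B,ℚ) × H⁴(B,ℚ) → ℚ` (ℚ-bilinear);
* `alg`, `alg'` — the ℚ-subspaces of algebraic classes (cycle classes) in the two degrees;
* `proj` — the projector of `H⁴(B,ℚ)` onto the Weil line (product of the Künneth projectors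
  `π¹` of the four factors with the `𝐅^{⊗4}`-diagonal idempotent: an ALGEBRAIC correspondence on
  the abelian variety `B`), `projT` its transpose under the pairing (also algebraic); the fields
  `proj_alg`, `projT_alg` record that algebraic correspondences map algebraic classes to algebraic
  classes, `pair_projT` the projection formula;
* `NumericalImpliesHomological'` — Lieberman's theorem (numerical equivalence coincides with
  homological equivalence for algebraic cycles on complex abelian varieties; Amer. J. Math. 90
  (1968) 366–374), in the degree of `c`;
* `LineProperty` — the Weil line is a rank-one `𝐅`-module whose `𝐅`-action is algebraic, so that
  a single non-zero algebraic element of `W` makes all of `W` algebraic (the `𝐅`-line core of the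
  bridge, formalised by seat p4 in `BridgeCore.lean`; here a named hypothesis).

The second half of the file is the Galois-component reduction of TIER3.md §6 item 16(α): for a
number field `K` every ℚ-linear functional `K → ℂ` is uniquely `λ ↦ ∑_τ a_τ τ(λ)` over the
embeddings `τ : K → ℂ` (Dedekind's independence of characters + the count of embeddings), hence
for `W = K • w₀` the period functional `λ ↦ ⟨c, λ • w₀⟩` vanishes identically iff every Galois
component `a_τ` vanishes: the projection of `f_*[S]` to the Weil line is non-zero iff SOME of
the six component periods is non-zero.

Axioms: propext, Classical.choice, Quot.sound only.
-/

namespace Summit.Ventures.HodgeRepro2.PairingTransfer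

open Module

/-- The linear-algebraic data of the Poincaré-duality step of the transfer: `V = H⁴(B,ℚ)`,
`V' = H^{2g-4}(B,ℚ)`, the pairing, the algebraic classes in both degrees, and the projector onto
the Weil line together with its transpose.  Every field is a hypothesis of the bridge argument;
none is asserted. -/
structure TransferData (V V' : Type*) [AddCommGroup V] [Module ℚ V]
    [AddCommGroup V'] [Module ℚ V'] where
  /-- The Poincaré pairing `⟨c, w⟩ = ∫_B c ∪ w`. -/
  pair : V' →ₗ[ℚ] V →ₗ[ℚ] ℚ
  /-- The algebraic classes in `H⁴(B,ℚ)`. -/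
  alg : Submodule ℚ V
  /-- The algebraic classes in `H^{2g-4}(B,ℚ)`. -/
  alg' : Submodule ℚ V'
  /-- The projector onto the Weil line (an algebraic correspondence on `B`). -/
  proj : V →ₗ[ℚ] V
  /-- Idempotence of the projector. -/
  proj_idem : ∀ v, proj (proj v) = proj v
  /-- The transpose of the projector under the pairing (an algebraic correspondence on `B`). -/
  projT : V' →ₗ[ℚ] V'
  /-- Projection formula: `⟨projT c, w⟩ = ⟨c, proj w⟩`. -/
  pair_projT : ∀ c w, pair (projT c) w = pair c (proj w)
  /-- Algebraic correspondences preserve algebraic classes (degree 4). -/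
  proj_alg : ∀ a ∈ alg, proj a ∈ alg
  /-- Algebraic correspondences preserve algebraic classes (degree `2g-4`). -/
  projT_alg : ∀ c ∈ alg', projT c ∈ alg'

variable {V V' : Type*} [AddCommGroup V] [Module ℚ V] [AddCommGroup V'] [Module ℚ V']

namespace TransferData

variable (D : TransferData V V')

/-- The Weil line, as the range of its projector. -/
def weilLine : Submodule ℚ V := LinearMap.range D.proj

/-- The projector fixes the Weil line pointwise. -/
theorem proj_eq_self_of_mem {w : V} (hw : w ∈ D.weilLine) : D.proj w = w := by
  obtain ⟨v, rfl⟩ := hw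
  exact D.proj_idem v

/-- The image of the projector lies in the Weil line. -/
theorem proj_mem_weilLine (v : V) : D.proj v ∈ D.weilLine := ⟨v, rfl⟩

/-- LIEBERMAN (degree `2g-4`): an algebraic class of complementary degree that is numerically
trivial against every algebraic class of degree 4 is zero in cohomology.  Printed: D. Lieberman,
«Numerical and homological equivalence of algebraic cycles on Hodge manifolds», Amer. J. Math. 90
(1968) 366–374 (cited in the held TeXed copy of Deligne–Milne, «Hodge cycles on abelian
varieties», endnote p. 87 ll. 5–10, and in Milne, Ann. of Math. 155 (2002), introduction). -/
def NumericalImpliesHomological' : Prop :=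
  ∀ e ∈ D.alg', (∀ a ∈ D.alg, D.pair e a = 0) → e = 0

/-- LIEBERMAN (degree 4): the symmetric statement for algebraic classes of degree 4. -/
def NumericalImpliesHomological : Prop :=
  ∀ a ∈ D.alg, (∀ e ∈ D.alg', D.pair e a = 0) → a = 0

/-- THE `𝐅`-LINE PROPERTY: one non-zero algebraic element of the Weil line makes the whole line
algebraic.  It follows from `W` being a rank-one `𝐅`-module whose `𝐅`-action `a ↦ (a,1,1,1)^*`
is by algebraic correspondences (the endomorphisms of `B`); that derivation is seat p4's
`BridgeCore.lean`.  Here it is a named hypothesis, so that this file and p4's compose without a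
twin. -/
def LineProperty : Prop :=
  ∀ w ∈ D.weilLine, w ≠ 0 → w ∈ D.alg → D.weilLine ≤ D.alg

/-- Under the `𝐅`-line property, either the Weil line is algebraic or it meets the algebraic
classes only in `0`. -/
theorem weilLine_le_alg_or_inf_eq_bot (hline : D.LineProperty) :
    D.weilLine ≤ D.alg ∨ ∀ w ∈ D.weilLine, w ∈ D.alg → w = 0 := by
  by_cases h : D.weilLine ≤ D.alg
  · exact Or.inl h
  · right
    intro w hw ha
    by_contra hne
    exact h (hline w hw hne ha)

/-- THE TRANSFER CLOSES ON ONE NON-ZERO PERIOD.  If an algebraic class `c` of complementary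
degree pairs non-trivially with some element of the Weil line, then the Weil line is algebraic.
Proof: `e := projT c` is algebraic, pairs with every algebraic class of degree 4 through its
projection to the Weil line, and pairs with `w` exactly as `c` does; if the Weil line contained
no non-zero algebraic class, `e` would be numerically trivial, hence zero (Lieberman), contradicting
`⟨e, w⟩ = ⟨c, w⟩ ≠ 0`. -/
theorem weilLine_le_alg_of_pair_ne_zero (hL : D.NumericalImpliesHomological')
    (hline : D.LineProperty) {c : V'} (hc : c ∈ D.alg') {w : V} (hw : w ∈ D.weilLine)
    (hne : D.pair c w ≠ 0) : D.weilLine ≤ D.alg := by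
  rcases D.weilLine_le_alg_or_inf_eq_bot hline with h | h
  · exact h
  · exfalso
    have he : D.projT c ∈ D.alg' := D.projT_alg c hc
    have hnum : ∀ a ∈ D.alg, D.pair (D.projT c) a = 0 := by
      intro a ha
      rw [D.pair_projT]
      have h0 : D.proj a = 0 := h _ (D.proj_mem_weilLine a) (D.proj_alg a ha)
      rw [h0, map_zero]
    have hzero : D.projT c = 0 := hL _ he hnum
    apply hne
    have := D.pair_projT c w
    rw [hzero, map_zero, LinearMap.zero_apply, D.proj_eq_self_of_mem hw] at this
    exact this.symm

/-- CONVERSE (the period is also NECESSARY): if the Weil line is non-zero and algebraic, then some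
algebraic class of complementary degree pairs non-trivially with it (Lieberman in degree 4). -/
theorem exists_pair_ne_zero_of_weilLine_le_alg (hL : D.NumericalImpliesHomological)
    (hW : D.weilLine ≠ ⊥) (h : D.weilLine ≤ D.alg) :
    ∃ c ∈ D.alg', ∃ w ∈ D.weilLine, D.pair c w ≠ 0 := by
  obtain ⟨w, hw, hw0⟩ := (Submodule.ne_bot_iff _).mp hW
  by_contra hcon
  apply hw0
  apply hL w (h hw)
  intro e he
  by_contra hne
  exact hcon ⟨e, he, w, hw, hne⟩

/-- EXACTLY WHERE NON-VANISHING ENTERS: under Lieberman's theorem in both degrees and the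
`𝐅`-line property, a non-zero Weil line is algebraic IF AND ONLY IF some algebraic class of
complementary degree has a non-zero period against it. -/
theorem weilLine_le_alg_iff (hL : D.NumericalImpliesHomological)
    (hL' : D.NumericalImpliesHomological') (hline : D.LineProperty) (hW : D.weilLine ≠ ⊥) :
    D.weilLine ≤ D.alg ↔ ∃ c ∈ D.alg', ∃ w ∈ D.weilLine, D.pair c w ≠ 0 := by
  constructor
  · exact D.exists_pair_ne_zero_of_weilLine_le_alg hL hW
  · rintro ⟨c, hc, w, hw, hne⟩
    exact D.weilLine_le_alg_of_pair_ne_zero hL' hline hc hw hne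

/-- The period functional of a class `c` on the Weil line: `w ↦ ⟨c, w⟩`. -/
def periodFunctional (c : V') : D.weilLine →ₗ[ℚ] ℚ :=
  (D.pair c).comp D.weilLine.subtype

/-- Evaluation of the period functional. -/
@[simp] theorem periodFunctional_apply (c : V') (w : D.weilLine) :
    D.periodFunctional c w = D.pair c w := rfl

end TransferData

/-! ## The Galois-component reduction (TIER3.md §6 item 16(α)) -/

section Dedekind

variable (K : Type*) [Field K] [NumberField K]

/-- An embedding `τ : K → ℂ` as a ℚ-linear map. -/
noncomputable def embeddingLinear (τ : K →+* ℂ) : K →ₗ[ℚ] ℂ :=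
  τ.toAddMonoidHom.toRatLinearMap

/-- Evaluation of an embedding read as a ℚ-linear map. -/
@[simp] theorem embeddingLinear_apply (τ : K →+* ℂ) (x : K) : embeddingLinear K τ x = τ x := rfl

/-- DEDEKIND: the embeddings `K → ℂ`, read as ℚ-linear maps `K → ℂ`, are linearly independent
over `ℂ`. -/
theorem linearIndependent_embeddingLinear :
    LinearIndependent ℂ (embeddingLinear K) := by
  have h₁ : LinearIndependent ℂ (fun τ : K →+* ℂ => (⇑τ : K → ℂ)) := by
    have := (linearIndependent_monoidHom K ℂ).comp (fun τ : K →+* ℂ => (τ : K →* ℂ))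
      RingHom.coe_monoidHom_injective
    exact this
  rw [Fintype.linearIndependent_iff] at h₁ ⊢
  intro g hg τ
  apply h₁ g _ τ
  funext x
  have := LinearMap.congr_fun hg x
  simpa [Finset.sum_apply, Pi.smul_apply] using this

/-- The number of embeddings equals the `ℂ`-dimension of the space of ℚ-linear maps `K → ℂ`. -/
theorem card_embeddings_eq_finrank :
    Fintype.card (K →+* ℂ) = finrank ℂ (K →ₗ[ℚ] ℂ) := by
  rw [NumberField.Embeddings.card K ℂ, Module.finrank_linearMap_self]

/-- The embeddings form a `ℂ`-basis of the ℚ-linear functionals `K → ℂ`. -/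
noncomputable def embeddingBasis : Basis (K →+* ℂ) ℂ (K →ₗ[ℚ] ℂ) :=
  basisOfLinearIndependentOfCardEqFinrank (linearIndependent_embeddingLinear K)
    (card_embeddings_eq_finrank K)

/-- The basis vectors are the embeddings. -/
@[simp] theorem embeddingBasis_apply (τ : K →+* ℂ) : embeddingBasis K τ = embeddingLinear K τ := by
  simp [embeddingBasis]

/-- The Galois components of a ℚ-linear functional `g : K → ℂ`: the unique coefficients with
`g = ∑_τ a_τ τ`. -/
noncomputable def galoisComponents (g : K →ₗ[ℚ] ℂ) : (K →+* ℂ) → ℂ :=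
  (embeddingBasis K).repr g

/-- EXISTENCE of the Galois decomposition: every ℚ-linear `g : K → ℂ` is
`λ ↦ ∑_τ a_τ τ(λ)` with `a = galoisComponents K g`. -/
theorem galoisComponents_spec (g : K →ₗ[ℚ] ℂ) (x : K) :
    g x = ∑ τ, galoisComponents K g τ * τ x := by
  conv_lhs => rw [← (embeddingBasis K).sum_repr g]
  simp [galoisComponents, Finset.sum_apply, embeddingBasis_apply]

/-- UNIQUENESS (Dedekind): if `∑_τ a_τ τ(λ) = 0` for every `λ ∈ K`, then every `a_τ = 0`. -/
theorem eq_zero_of_sum_embeddings_eq_zero (a : (K →+* ℂ) → ℂ)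
    (h : ∀ x : K, ∑ τ, a τ * τ x = 0) : ∀ τ, a τ = 0 := by
  have hind := Fintype.linearIndependent_iff.mp (linearIndependent_embeddingLinear K)
  apply hind a
  ext x
  simpa [Finset.sum_apply, Pi.smul_apply] using h x

/-- The Galois components of `g` all vanish iff `g` vanishes. -/
theorem galoisComponents_eq_zero_iff (g : K →ₗ[ℚ] ℂ) :
    (∀ τ, galoisComponents K g τ = 0) ↔ g = 0 := by
  constructor
  · intro h
    ext x
    rw [galoisComponents_spec K g x]
    simp [h]
  · rintro rfl
    simp [galoisComponents]

end Dedekind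

/-! ## The period functional on a rank-one Weil line, Galois component by Galois component -/

section Components

variable {K : Type*} [Field K] [NumberField K]
variable (D : TransferData V V')

/-- The period functional `λ ↦ ⟨c, λ • w₀⟩` along a generator `w₀` of the Weil line, for a
`K`-module structure on the Weil line compatible with its ℚ-structure; as a ℚ-linear map
`K → ℂ` (the rational value embedded in `ℂ`). -/
noncomputable def periodAlong [Module K D.weilLine] [IsScalarTower ℚ K D.weilLine]
    (c : V') (w₀ : D.weilLine) : K →ₗ[ℚ] ℂ :=
  (Algebra.linearMap ℚ ℂ).comp
    ((D.periodFunctional c).comp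
      ((LinearMap.toSpanSingleton K (↥D.weilLine) w₀).restrictScalars ℚ))

/-- Evaluation of the period functional along `w₀`. -/
@[simp] theorem periodAlong_apply [Module K D.weilLine] [IsScalarTower ℚ K D.weilLine]
    (c : V') (w₀ : D.weilLine) (x : K) :
    periodAlong D c w₀ x = ((D.pair c (x • w₀ : D.weilLine) : ℚ) : ℂ) := rfl

/-- The Galois components `a_τ` of the period of `c` along `w₀`:
`⟨c, λ • w₀⟩ = ∑_τ a_τ τ(λ)` for all `λ ∈ K` (TIER3 §6 item 16(α): «a rational class
`w = λ w₀` has `⟨f_*[S], w⟩ = ∑_j τ′_j(λ) a_j`»). -/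
noncomputable def periodComponents [Module K D.weilLine] [IsScalarTower ℚ K D.weilLine]
    (c : V') (w₀ : D.weilLine) : (K →+* ℂ) → ℂ :=
  galoisComponents K (periodAlong D c w₀)

/-- The Galois decomposition of the period: `⟨c, λ • w₀⟩ = ∑_τ a_τ τ(λ)`. -/
theorem periodComponents_spec [Module K D.weilLine] [IsScalarTower ℚ K D.weilLine]
    (c : V') (w₀ : D.weilLine) (x : K) :
    ((D.pair c (x • w₀ : D.weilLine) : ℚ) : ℂ) = ∑ τ, periodComponents D c w₀ τ * τ x := by
  rw [← periodAlong_apply, periodComponents, galoisComponents_spec]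

/-- THE REDUCTION OF ITEM 16(α): if `w₀` generates the Weil line over `K`, the period of `c`
vanishes on the whole Weil line iff every Galois component `a_τ` vanishes — equivalently, the
projection of `c` to the Weil line is non-zero iff SOME component period is non-zero (the
embeddings being linearly independent). -/
theorem pair_eq_zero_forall_iff_periodComponents_eq_zero
    [Module K D.weilLine] [IsScalarTower ℚ K D.weilLine]
    (c : V') (w₀ : D.weilLine) (hgen : ∀ w : D.weilLine, ∃ x : K, w = x • w₀) :
    (∀ w ∈ D.weilLine, D.pair c w = 0) ↔ ∀ τ : K →+* ℂ, periodComponents D c w₀ τ = 0 := by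
  rw [periodComponents, galoisComponents_eq_zero_iff]
  constructor
  · intro h
    ext x
    simp only [periodAlong_apply, LinearMap.zero_apply, Rat.cast_eq_zero]
    exact h _ (x • w₀).2
  · intro h w hw
    obtain ⟨x, hx⟩ := hgen ⟨w, hw⟩
    have := LinearMap.congr_fun h x
    simp only [periodAlong_apply, LinearMap.zero_apply, Rat.cast_eq_zero] at this
    have hw' : w = ((x • w₀ : D.weilLine) : V) := by
      have := congrArg Subtype.val hx
      simpa using this
    rw [hw', this]

/-- The non-vanishing hook, component form: some Galois component of the period of `c` along a
generator `w₀` is non-zero iff `c` has a non-zero period against the Weil line. -/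
theorem exists_periodComponent_ne_zero_iff
    [Module K D.weilLine] [IsScalarTower ℚ K D.weilLine]
    (c : V') (w₀ : D.weilLine) (hgen : ∀ w : D.weilLine, ∃ x : K, w = x • w₀) :
    (∃ τ : K →+* ℂ, periodComponents D c w₀ τ ≠ 0) ↔ ∃ w ∈ D.weilLine, D.pair c w ≠ 0 := by
  have := pair_eq_zero_forall_iff_periodComponents_eq_zero D c w₀ hgen
  constructor
  · rintro ⟨τ, hτ⟩
    by_contra hcon
    apply hτ
    apply this.mp _ τ
    intro w hw
    by_contra hne
    exact hcon ⟨w, hw, hne⟩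
  · rintro ⟨w, hw, hne⟩
    by_contra hcon
    apply hne
    apply this.mpr _ w hw
    intro τ
    by_contra hτ
    exact hcon ⟨τ, hτ⟩

/-- THE TRANSFER, COMPONENT FORM: one non-zero Galois component of the period of an algebraic
class `c` of complementary degree along a generator of the Weil line closes the transfer. -/
theorem weilLine_le_alg_of_periodComponent_ne_zero
    [Module K D.weilLine] [IsScalarTower ℚ K D.weilLine]
    (hL : D.NumericalImpliesHomological') (hline : D.LineProperty)
    {c : V'} (hc : c ∈ D.alg') (w₀ : D.weilLine)
    (hgen : ∀ w : D.weilLine, ∃ x : K, w = x • w₀)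
    (hne : ∃ τ : K →+* ℂ, periodComponents D c w₀ τ ≠ 0) : D.weilLine ≤ D.alg := by
  obtain ⟨w, hw, hne'⟩ := (exists_periodComponent_ne_zero_iff D c w₀ hgen).mp hne
  exact D.weilLine_le_alg_of_pair_ne_zero hL hline hc hw hne'

end Components

end Summit.Ventures.HodgeRepro2.PairingTransfer
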